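import Summits.HodgeConjecture.HodgeConjecture.Theorems.HeckePrymWeilHodgeWeilOfSemiregularCleanLci
import HarnessLib

/-!
# `WeilTwelvefoldsSqrtMinus7` from `DeligneWeilFamily`, the registered stub `stub_semiregularCleanLci` and `BlochSemiregularSpread 12 6`

Route `HeckePrymWeil` (sub-problem `HodgeConjecture`); lead seat c14 of crux `WeilTwelvefoldsSqrtMinus7`
(stmt-HodgeConjecture-1261), line `semiregular-clean-lci-anchor`: the line's composition at
`(p, k) = (7, 6)` with its fourth stub (the algebraicity-locus structure theorem) discharged in the tree —
the crux BY NAME from the route item `DeligneWeilFamily` (stmt-HodgeConjecture-16866), the registered stub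
`stub_semiregularCleanLci` (VERBATIM, as hypothesis) and the named print fact `BlochSemiregularSpread 12 6`,
via the general `hodgeWeil_of_semiregularCleanLci_of_globalAction`.  CONDITIONAL on those three; no
`sorry`, no new definition.
-/

noncomputable section

-- every declaration of this problem lives in `Summit.HodgeConjecture.HodgeConjecture.…` (summit = sub-problem)
set_option linter.dupNamespace false

open CategoryTheory AlgebraicGeometry Limits MonoidalCategory CartesianMonoidalCategory
open Literature.AlgebraicGeometry Literature.AlgebraicGeometry.Motives
  Literature.AlgebraicGeometry.HodgeTheory Literature.AlgebraicTopology.SingularHomology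


namespace Summit.HodgeConjecture.HodgeConjecture.Theorems.WeilTwelvefoldsSqrtMinus7.SemiregularCleanLciAnchor

open Summit.HodgeConjecture.HodgeConjecture.Theorems.HeckePrymWeilLine
open Summit.HodgeConjecture.HodgeConjecture.Theses.HeckePrymWeil

/-- **`WeilTwelvefoldsSqrtMinus7` from the route item `DeligneWeilFamily`, the line's registered stub
`stub_semiregularCleanLci` (VERBATIM, as hypothesis `h₂`) and `BlochSemiregularSpread 12 6`** — the
composition of the line `semiregular-clean-lci-anchor` with its fourth stub (the algebraicity-locus
structure theorem) discharged in the tree: the route item gives the `K`-action rendering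
(`kAction_of_deligneWeilFamily`), hence the global action (`deligne1982_weilFamily_globalAction_of_kAction`),
and `hodgeWeil_of_semiregularCleanLci_of_globalAction` at `(p, k) = (7, 6)` is the crux after the
harmless recasts `12 = 2·6`, `(7 : ℤ) = ((7 : ℕ) : ℤ)`.
[cite: Bloch1972Semiregularity, Thm. (7.4), Remark (7.5)] [cite: Deligne1982HodgeCycles, proof of Thm. 4.8] -/
theorem weilTwelvefoldsSqrtMinus7_of_deligneWeilFamily_of_semiregularCleanLci_of_blochSpread
    (h₁ : DeligneWeilFamily)
    (h₂ : ∀ (Y : AbelianVariety ℂ) (Ψ : Y ⟶ Y), Y.dim = 2 * 6 → Ψ ≫ Ψ = -((7 : ℤ) • 𝟙 Y) →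
      (∃ (A₁ : AbelianVariety ℂ) (f₁ : Y ⟶ A₁.prod A₁) (g₁ : A₁.prod A₁ ⟶ Y) (m : ℕ),
          A₁.dim = 6 ∧ 0 < m ∧ f₁ ≫ g₁ = m • 𝟙 Y ∧ Flat f₁.hom.hom.hom.left ∧
          g₁ ≫ Ψ = AbelianVariety.prodLift (AbelianVariety.snd A₁ A₁ ≫ (-((7 : ℤ) • 𝟙 A₁)))
            (AbelianVariety.fst A₁ A₁) ≫ g₁) →
      ∀ (e : ProjectiveEmbedding Y.X) (a : complexBetti (projectiveSpace e.n ℂ) 2),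
        IsRationalClass a → a ≠ 0 →
        complexBetti.map Ψ.hom.hom.hom 2 (complexBetti.map e.ι 2 a) = (7 : ℂ) • complexBetti.map e.ι 2 a →
      ∀ (x₀ : complexBetti Y.X (2 * 6)),
        x₀ ∈ weilClassesOf Y Ψ 6 7 → x₀ ≠ 0 → IsRationalClass x₀ →
        IsOfHodgeType (2 * 6) Y.X (2 * 6) 6 6 x₀ →
        ∃ (Z : Scheme.{0}) (i : Z ⟶ Y.X.left) (θ : complexBetti (projectiveSpace e.n ℂ) (2 * 6)) (α : ℚ),
          IsClosedImmersion i ∧ IsRegularImmersionOfCodim i 6 ∧ AlgebraicGeometry.IsIntegral Z ∧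
          (∀ z ∈ Set.range i.base, ((6 : ℕ) : ℕ∞) ≤ Order.coheight z) ∧
          IsBlochSemiregular i 12 6 ∧ IsRationalClass θ ∧ α ≠ 0 ∧
          ((α : ℂ) • x₀ + complexBetti.map e.ι (2 * 6) θ) ∈
            classesSupportedOn Y.X (Set.range i.base) (2 * 6))
    (h₃ : BlochSemiregularSpread 12 6) :
    WeilTwelvefoldsSqrtMinus7 := by
  intro A φ hA hφ c hrat hH hW
  have hA' : A.dim = 2 * 6 := by simpa using hA
  have hφ' : φ ≫ φ = -(((7 : ℕ) : ℤ) • 𝟙 A) := by exact_mod_cast hφ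
  have hW' : c ∈ Module.End.eigenspace (complexBetti.map (𝟙 A + φ).hom.hom.hom (2 * 6)).hom
        ((1 + Complex.I * (Real.sqrt ((7 : ℕ) : ℝ) : ℂ)) ^ (2 * 6)) ⊔
      Module.End.eigenspace (complexBetti.map (𝟙 A + φ).hom.hom.hom (2 * 6)).hom
        ((1 - Complex.I * (Real.sqrt ((7 : ℕ) : ℝ) : ℂ)) ^ (2 * 6)) := by
    exact_mod_cast hW
  have hH' : IsOfHodgeType (2 * 6) A.X (2 * 6) 6 6 c := hH
  have hGA : deligne1982_weilFamily_globalAction :=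
    deligne1982_weilFamily_globalAction_of_kAction (kAction_of_deligneWeilFamily h₁)
  -- the registered stub, recast to the general supply shape at `(p, k) = (7, 6)`
  have hS : ∀ (Y : AbelianVariety ℂ) (Ψ : Y ⟶ Y), Y.dim = 2 * 6 → Ψ ≫ Ψ = -(((7 : ℕ) : ℤ) • 𝟙 Y) →
      (∃ (A₁ : AbelianVariety ℂ) (f₁ : Y ⟶ A₁.prod A₁) (g₁ : A₁.prod A₁ ⟶ Y) (m : ℕ),
          A₁.dim = 6 ∧ 0 < m ∧ f₁ ≫ g₁ = m • 𝟙 Y ∧ Flat f₁.hom.hom.hom.left ∧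
          g₁ ≫ Ψ = AbelianVariety.prodLift (AbelianVariety.snd A₁ A₁ ≫ (-(((7 : ℕ) : ℤ) • 𝟙 A₁)))
            (AbelianVariety.fst A₁ A₁) ≫ g₁) →
      ∀ (e : ProjectiveEmbedding Y.X) (a : complexBetti (projectiveSpace e.n ℂ) 2),
        IsRationalClass a → a ≠ 0 →
        complexBetti.map Ψ.hom.hom.hom 2 (complexBetti.map e.ι 2 a) =
          ((7 : ℕ) : ℂ) • complexBetti.map e.ι 2 a →
      ∀ (x₀ : complexBetti Y.X (2 * 6)),
        x₀ ∈ weilClassesOf Y Ψ 6 7 → x₀ ≠ 0 → IsRationalClass x₀ →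
        IsOfHodgeType (2 * 6) Y.X (2 * 6) 6 6 x₀ →
        ∃ (Z : Scheme.{0}) (i : Z ⟶ Y.X.left) (θ : complexBetti (projectiveSpace e.n ℂ) (2 * 6)) (α : ℚ),
          IsClosedImmersion i ∧ IsRegularImmersionOfCodim i 6 ∧ AlgebraicGeometry.IsIntegral Z ∧
          (∀ z ∈ Set.range i.base, ((6 : ℕ) : ℕ∞) ≤ Order.coheight z) ∧
          IsBlochSemiregular i (2 * 6) 6 ∧ IsRationalClass θ ∧ α ≠ 0 ∧
          ((α : ℂ) • x₀ + complexBetti.map e.ι (2 * 6) θ) ∈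
            classesSupportedOn Y.X (Set.range i.base) (2 * 6) := by
    intro Y Ψ hY hΨ htensor e a ha ha0 hKsym x₀ hx₀ hx₀ne hx₀rat hx₀H
    have hΨ' : Ψ ≫ Ψ = -((7 : ℤ) • 𝟙 Y) := by exact_mod_cast hΨ
    have htensor' : ∃ (A₁ : AbelianVariety ℂ) (f₁ : Y ⟶ A₁.prod A₁) (g₁ : A₁.prod A₁ ⟶ Y) (m : ℕ),
        A₁.dim = 6 ∧ 0 < m ∧ f₁ ≫ g₁ = m • 𝟙 Y ∧ Flat f₁.hom.hom.hom.left ∧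
        g₁ ≫ Ψ = AbelianVariety.prodLift (AbelianVariety.snd A₁ A₁ ≫ (-((7 : ℤ) • 𝟙 A₁)))
          (AbelianVariety.fst A₁ A₁) ≫ g₁ := by
      obtain ⟨A₁, f₁, g₁, m, hA₁, hm, hfg, hf, hg₁⟩ := htensor
      exact ⟨A₁, f₁, g₁, m, hA₁, hm, hfg, hf, by exact_mod_cast hg₁⟩
    have hKsym' : complexBetti.map Ψ.hom.hom.hom 2 (complexBetti.map e.ι 2 a) =
        (7 : ℂ) • complexBetti.map e.ι 2 a := by exact_mod_cast hKsym
    obtain ⟨Z, i, θ, α, hci, hreg, hint, hcodim, hsr, hθ, hα, hsupp⟩ :=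
      h₂ Y Ψ hY hΨ' htensor' e a ha ha0 hKsym' x₀ hx₀ hx₀ne hx₀rat hx₀H
    exact ⟨Z, i, θ, α, hci, hreg, hint, hcodim, hsr, hθ, hα, hsupp⟩
  have hB : BlochSemiregularSpread (2 * 6) 6 := h₃
  exact hodgeWeil_of_semiregularCleanLci_of_globalAction hGA (p := 7) (by norm_num) (by norm_num) le_rfl
    (k := 6) (by norm_num) hS hB A φ hA' hφ' c hrat hH' hW'

end Summit.HodgeConjecture.HodgeConjecture.Theorems.WeilTwelvefoldsSqrtMinus7.SemiregularCleanLciAnchor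

end
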